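/-
Copyright: the b2b-balaban T⁴-continuum CRUX team, row NE7b leaf lineage `t4-ne7b-formalise-leaf-03` (gen 155). Project licence.
-/
import Summits.QuantumFields.BalabanUV.T4Continuum.Spine.NE7b.SupBackgroundTorusCarrier

/-!
# THE RESPONSE AND THE COVARIANCE ON EVERY TORUS: any right inverse `D` of `Q′` solving the linearised fibre equation at a periodic
# background (the response `Dσ(w)`) and any fibre solution operator `C` (the covariance `C̃(w)`) ARE operators of torus carriers —
# `Dt := Rf ∘ D ∘ Ec : ((ℤ∕s)^d → ℝ) →L ((ℤ∕(n+1)s)^d → ℝ)`, `Ct := Rf ∘ C ∘ Ef` — with the SAME norm bounds, their periodisations being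
# `D` ∕ `C` of the periodisations: (73) `linearised_periodic_of_letters` fed to SBT `torus_operator_of_periodic` (row NE7b, node U5c;
# the OWNER's located note (ii) on W-ne7bp1-g115-11, generic in the operators; [folklore])

Cell `pub-balaban`, sub-cell `t4`, spine estimate NE7b (`T4WeightBudget.RelWeightBound`; the cell's OWN estimate — NOT PRINTED in
[Bałaban 1983–89], NOT PROVED).  Crux-route work under `Spine/NE7b/` by a row leaf (`t4-ne7b-formalise-leaf-03` gen 155) under
FREEZE (0)'s crux-prover clause, on the row OWNER's word (`t4-ne7b-p1` g115, W-ne7bp1-g115-11 (ii): «the response `Dσ(w)` and the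
covariance `C̃(w)` transfer by (73) `linearised_periodic_of_letters` the same way — a §2 of yours or a sibling, your call»); NOTHING of
Bałaban's is named as a Lean object, valued or asserted; no `T4Continuum/Support` leaf typed; no `def`, no notation (the torus
operators are the explicit compositions `(Rf.comp D).comp Ec`, `(Rf.comp C).comp Ef`); zero `sorry`.  Imports (BY NAME): this lineage's
SBT `…SupBackgroundTorusCarrier` (`torus_operator_of_periodic`; through it PTC's carriers `norm_periodise` ∕ `restrict_periodise` ∕
`periodise_periodic` ∕ `natCast_mul_smul_eq` and (73) `…SupBackgroundPeriodic.linearised_periodic_of_letters`, (72)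
`…AugmentedInversePeriodic.fibreProj_periodic`).

WHAT IS PROVED ([folklore]; `ℓ^∞ := lp (fun _ : X d => ℝ) ∞`; GENERIC in the operators — the linearised data are (73) §4's binders
VERBATIM: `Q′ ∕ A ∕ P` with displayed actions, `N′ = g·` with `|g| ≤ λ`, the smallness letter `2λ·A_G K_d(δ_u∕4)(1 + C_∞) < 1`, and `g`
`side n • (s • t)`-periodic — e.g. `g = u′ ∘ σ(w)` at the background of an `s`-periodic `w`, periodic by (73) §3 ∕ (74)):
* §1 **`response_periodic_of_letters`** (a right inverse `D` of `Q′` with `P(A(Dv) + N′(Dv)) = 0` maps `s`-periodic `v` to periodic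
  `Dv`) and **`covariance_periodic_of_letters`** (`C` with `Q′(Cf) = 0`, `P(A(Cf) + N′(Cf)) = Pf` maps periodic `f` to periodic `Cf`).
* §2 **`response_torus_of_letters`**: with PTC carrier maps `Ef ∕ Rf` (fine torus `Site d ((n+1)s)`), `Ec ∕ Rc` (coarse torus
  `Site d s`): `Ef (Dt vt) = D (Ec vt)`, `‖Dt‖ ≤ ‖D‖`, and the torus block means of `Dt vt` are `vt` (`Rc (Q′(Ef (Dt vt))) = vt`), for
  `Dt := (Rf.comp D).comp Ec`; **`covariance_torus_of_letters`**: `Ef (Ct gt) = C (Ef gt)`, `‖Ct‖ ≤ ‖C‖`, `Q′(Ef (Ct gt)) = 0`, for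
  `Ct := (Rf.comp C).comp Ef`.
* §3 toy: the zero field has every period.

HONEST (what this is NOT).  Carrier bookkeeping, generic: NO instance is typed here — the instances on (63)'s `Dσ(w)` ∕ `C̃(w)` need
the background's periodicity as a tree theorem ((74) `background_periodic`, retry lane at this cut) and are then one application
each; the weighted ∕ far-support letters of (63)–(71) are not transferred (they are `ℓ^∞` statements about the same operators and
hold verbatim for the periodisations); constants the operators' own; cubic periods; scalar skeleton, not the covariant operators
((A3), NC-NE7b-α UNRULED); nothing of Bałaban's.  BY-NAME EFFECT ON THE WALL: NONE.  NE7b NOT PRINTED ∕ NOT PROVED; spine PROVED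
0∕9; rung (B)+1 on a FINITE torus — NOT infinite volume, NOT the mass gap, NOT Clay.  HONEST DEPENDENCY: continuum YM on T⁴ ⇐
BetaPertH ∧ nine spine estimates (0∕9 proved); BetaPertH ⇐ (D1) ∧ (D4) ∧ CAP+tail; G-an2-4 gates asym, D1 and NE2∕3∕4.
-/

set_option autoImplicit false

noncomputable section

namespace Summit.QuantumFields.BalabanUV.T4Continuum.NE7b.SupLinearisedTorusCarrier

open Set Metric
open scoped ENNReal
open Literature.MathematicalPhysics.QuantumFieldTheory.Balaban1983to89
open B4Sect5Proof (latticeConst)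
open B6QGQLower276 (X blk B side AX)
open B6QGQDecay237 (deltaU)
open B5Hk103ScalarZd (nbhd deltaH)
open Summit.QuantumFields.BalabanUV.Beta.D1BFx.BlockColumnSupNorm (cHs)
open Summit.QuantumFields.BalabanUV.Beta.D1BFx.PointColumnSplit (cKL cG0 cSplit)
open Summit.QuantumFields.BalabanUV.Beta.D1BFx.PointColumnDecay (cFar)
open Beta (Site siteOf windowMap)
open AugmentedInversePeriodic (fibreProj_periodic)
open SupBackgroundPeriodic (linearised_periodic_of_letters)
open PeriodicSupTorusCarrier (restrict_periodise periodise_periodic natCast_mul_smul_eq)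
open SupBackgroundTorusCarrier (torus_operator_of_periodic)

variable {d : ℕ}

section Linearised

variable (hd : 3 ≤ d) (n : ℕ) {a : ℝ} (ha : 0 < a)
  (Dop Aop Pop Nop : lp (fun _ : X d => ℝ) ∞ →L[ℝ] lp (fun _ : X d => ℝ) ∞)
  (hD : ∀ (f : lp (fun _ : X d => ℝ) ∞) (y : X d), Dop f y = (((n : ℝ) + 1) ^ d)⁻¹ * ∑ p ∈ B n y, f p)
  (hA : ∀ (f : lp (fun _ : X d => ℝ) ∞) (p : X d), Aop f p = ∑ r ∈ nbhd n p, AX n a p r * f r)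
  (hP : ∀ (f : lp (fun _ : X d => ℝ) ∞) (p : X d), Pop f p = f p - (((n : ℝ) + 1) ^ d)⁻¹ * ∑ p' ∈ B n (blk n p), f p')
  {g : X d → ℝ} {lam : ℝ} (hN : ∀ (f : lp (fun _ : X d => ℝ) ∞) (p : X d), Nop f p = g p * f p) (hg : ∀ p, |g p| ≤ lam)
  (hsmall : 2 * lam * (((cG0 d * cKL d (d - 2) + cSplit d a) * Real.exp (2 * deltaU d a)
      + cFar d a * Real.exp (4 * deltaU d a) / deltaU d a ^ 2) * latticeConst d (deltaU d a / 4)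
        * (1 + cHs d a * latticeConst d (deltaH d a))) < 1)
  (s : ℕ) (hgper : ∀ q t : X d, g (q + side n • ((s : ℤ) • t)) = g q)
include hd ha hD hA hP hN hg hsmall hgper

/-! ## §1. The response and the covariance preserve periodicity ((73) §4) -/

/-- **A RIGHT INVERSE OF `Q′` SOLVING THE LINEARISED FIBRE EQUATION MAPS `s`-PERIODIC COARSE FIELDS TO PERIODIC FINE FIELDS** — the
response `Dσ(w)`'s shape ((63): `Q′∘D = 1`, `P(A(Dv) + N′(Dv)) = 0`); (73) `linearised_periodic_of_letters` at `κ₀ = 0`. [folklore] -/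
theorem response_periodic_of_letters (D : lp (fun _ : X d => ℝ) ∞ →L[ℝ] lp (fun _ : X d => ℝ) ∞)
    (hD1 : ∀ v, Dop (D v) = v) (hD2 : ∀ v, Pop (Aop (D v) + Nop (D v)) = 0)
    (v : lp (fun _ : X d => ℝ) ∞) (hv : ∀ y t : X d, v (y + (s : ℤ) • t) = v y) (q t : X d) :
    D v (q + (((n + 1) * s : ℕ) : ℤ) • t) = D v q := by
  rw [natCast_mul_smul_eq]
  exact linearised_periodic_of_letters hd n ha Dop Aop Pop Nop hD hA hP hN hg hsmall s hgper (D v) v 0 (hD1 v) (hD2 v) hv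
    (fun q t => by rw [lp.coeFn_zero, Pi.zero_apply, Pi.zero_apply]) q t

/-- **A FIBRE SOLUTION OPERATOR MAPS PERIODIC FINE FIELDS TO PERIODIC FINE FIELDS** — the covariance `C̃(w)`'s shape ((60)∕(63):
`Q′(Cf) = 0`, `P(A(Cf) + N′(Cf)) = Pf`); (73) §4 at `v = 0`, `κ₀ = Pf` (periodic by (72) `fibreProj_periodic`). [folklore] -/
theorem covariance_periodic_of_letters (C : lp (fun _ : X d => ℝ) ∞ →L[ℝ] lp (fun _ : X d => ℝ) ∞)
    (hC1 : ∀ f, Dop (C f) = 0) (hC2 : ∀ f, Pop (Aop (C f) + Nop (C f)) = Pop f)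
    (f : lp (fun _ : X d => ℝ) ∞) (hf : ∀ q t : X d, f (q + (((n + 1) * s : ℕ) : ℤ) • t) = f q) (q t : X d) :
    C f (q + (((n + 1) * s : ℕ) : ℤ) • t) = C f q := by
  have hf' : ∀ q t : X d, f (q + side n • ((s : ℤ) • t)) = f q := fun q t => by
    rw [← natCast_mul_smul_eq]; exact hf q t
  rw [natCast_mul_smul_eq]
  exact linearised_periodic_of_letters hd n ha Dop Aop Pop Nop hD hA hP hN hg hsmall s hgper (C f) 0 (Pop f) (hC1 f) (hC2 f)
    (fun y t => by rw [lp.coeFn_zero, Pi.zero_apply, Pi.zero_apply]) (fun q t => by rw [hP, hP]; exact fibreProj_periodic n s hf' q t)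
    q t

/-! ## §2. The response and the covariance as operators of torus carriers -/

/-- **THE RESPONSE ON THE TORUS**: `Dt := Rf ∘ D ∘ Ec : (Site d s → ℝ) →L (Site d ((n+1)s) → ℝ)` has `Ef (Dt vt) = D (Ec vt)`,
`‖Dt‖ ≤ ‖D‖`, and torus block means `Rc (Q′(Ef (Dt vt))) = vt` — SBT `torus_operator_of_periodic` on §1. [folklore] -/
theorem response_torus_of_letters [NeZero s] (D : lp (fun _ : X d => ℝ) ∞ →L[ℝ] lp (fun _ : X d => ℝ) ∞)
    (hD1 : ∀ v, Dop (D v) = v) (hD2 : ∀ v, Pop (Aop (D v) + Nop (D v)) = 0)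
    {Ef : (Site d ((n + 1) * s) → ℝ) →L[ℝ] lp (fun _ : X d => ℝ) ∞} {Rf : lp (fun _ : X d => ℝ) ∞ →L[ℝ] (Site d ((n + 1) * s) → ℝ)}
    {Ec : (Site d s → ℝ) →L[ℝ] lp (fun _ : X d => ℝ) ∞} {Rc : lp (fun _ : X d => ℝ) ∞ →L[ℝ] (Site d s → ℝ)}
    (hEf : ∀ (g' : Site d ((n + 1) * s) → ℝ) (q : X d), Ef g' q = g' (siteOf d ((n + 1) * s) q))
    (hRf : ∀ (h : lp (fun _ : X d => ℝ) ∞) (x : Site d ((n + 1) * s)), Rf h x = h (windowMap d ((n + 1) * s) x))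
    (hEc : ∀ (g' : Site d s → ℝ) (q : X d), Ec g' q = g' (siteOf d s q))
    (hRc : ∀ (h : lp (fun _ : X d => ℝ) ∞) (x : Site d s), Rc h x = h (windowMap d s x)) :
    (∀ vt, Ef (((Rf.comp D).comp Ec) vt) = D (Ec vt)) ∧ ‖(Rf.comp D).comp Ec‖ ≤ ‖D‖ ∧
      ∀ vt, Rc (Dop (Ef (((Rf.comp D).comp Ec) vt))) = vt := by
  obtain ⟨h1, h2⟩ := torus_operator_of_periodic D
    (fun v hv => response_periodic_of_letters hd n ha Dop Aop Pop Nop hD hA hP hN hg hsmall s hgper D hD1 hD2 v hv) hEc hEf hRf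
  exact ⟨h1, h2, fun vt => by rw [h1, hD1, restrict_periodise hEc hRc]⟩

/-- **THE COVARIANCE ON THE TORUS**: `Ct := Rf ∘ C ∘ Ef : (Site d ((n+1)s) → ℝ) →L (Site d ((n+1)s) → ℝ)` has `Ef (Ct gt) = C (Ef gt)`,
`‖Ct‖ ≤ ‖C‖`, and lands in the torus fibre (`Q′(Ef (Ct gt)) = 0`) — SBT `torus_operator_of_periodic` on §1. [folklore] -/
theorem covariance_torus_of_letters [NeZero s] (C : lp (fun _ : X d => ℝ) ∞ →L[ℝ] lp (fun _ : X d => ℝ) ∞)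
    (hC1 : ∀ f, Dop (C f) = 0) (hC2 : ∀ f, Pop (Aop (C f) + Nop (C f)) = Pop f)
    {Ef : (Site d ((n + 1) * s) → ℝ) →L[ℝ] lp (fun _ : X d => ℝ) ∞} {Rf : lp (fun _ : X d => ℝ) ∞ →L[ℝ] (Site d ((n + 1) * s) → ℝ)}
    (hEf : ∀ (g' : Site d ((n + 1) * s) → ℝ) (q : X d), Ef g' q = g' (siteOf d ((n + 1) * s) q))
    (hRf : ∀ (h : lp (fun _ : X d => ℝ) ∞) (x : Site d ((n + 1) * s)), Rf h x = h (windowMap d ((n + 1) * s) x)) :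
    (∀ gt, Ef (((Rf.comp C).comp Ef) gt) = C (Ef gt)) ∧ ‖(Rf.comp C).comp Ef‖ ≤ ‖C‖ ∧
      ∀ gt, Dop (Ef (((Rf.comp C).comp Ef) gt)) = 0 := by
  obtain ⟨h1, h2⟩ := torus_operator_of_periodic C
    (fun f hf => covariance_periodic_of_letters hd n ha Dop Aop Pop Nop hD hA hP hN hg hsmall s hgper C hC1 hC2 f hf) hEf hEf hRf
  exact ⟨h1, h2, fun gt => by rw [h1, hC1]⟩

end Linearised

/-! ## §3. Toy -/

/-- Toy: the zero field of `ℓ^∞` has every period (the datum `v = 0` ∕ `κ₀ = 0` fed to (73) §4 in §1). [folklore] -/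
example (c q t : X d) : (0 : lp (fun _ : X d => ℝ) ∞) (q + c • t) = (0 : lp (fun _ : X d => ℝ) ∞) q := by
  rw [lp.coeFn_zero, Pi.zero_apply, Pi.zero_apply]

end Summit.QuantumFields.BalabanUV.T4Continuum.NE7b.SupLinearisedTorusCarrier

end
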